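import Summits.Ventures.LatticeQCDFlow.Exactness.IMHCommonRandomNumbersSplit
import Summits.Ventures.LatticeQCDFlow.Exactness.IMHModeRenewal
import HarnessLib

/-!
# Common random numbers, sharpness: the cold run merges with every other run EXACTLY when it first accepts —
# from (cold, anything off the mode) the two runs are still apart after `n` shared updates with probability
# EXACTLY `rⁿ`

HONEST FRAMING: exact (Metropolis-corrected) sampling algorithms for lattice gauge theory;
figures of merit are autocorrelation/cost numbers at stated couplings and volumes; no
continuum-physics claim.

Venture `LatticeQCDFlow` (cell pub-lqcd), topic `Exactness`; FANOUT row 30 (lean-1, GEN-36).  NEW WORK of the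
cell, general state space with measurable points.  `Exactness/IMHCommonRandomNumbersSplit` (this generation)
proved that two runs of flow-MCMC `K = indepMH q w` fed the same proposals and uniforms have merged after `n`
updates except with probability AT MOST `rⁿ` (`r = 1 − 1/w(x₀)`), from every initial coupling.  Here the bound is
shown to be ATTAINED, by the pair (cold run, any run not at the mode), for an atom-free proposal (`q{x₀} = 0` — the
autoregressive gauge proposals are atom-free):

* §1 **`bind_crnPair_map_fst`**, **`iterate_bind_crnPair_map_fst`** (and `snd`) — the coordinates of the pair law
  after `n` shared updates are the two runs' one-time laws `(μ̂₀∘fst⁻¹)Kⁿ`, `(μ̂₀∘snd⁻¹)Kⁿ` (bookkeeping).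
* §2 **`iterate_bind_crnPair_fst_atMode_eq`** — if the first run starts at the mode, `P(X_n = x₀) = rⁿ` EXACTLY
  (GEN-31's cold-start law `δ_{x₀}Kⁿ = (1 − rⁿ)·π + rⁿ·δ_{x₀}` read on the pair chain; `π{x₀} = 0`);
  **`iterate_bind_crnPair_snd_atMode_eq_zero`** — if the second run starts off the mode (`μ̂₀(X′_0 = x₀) = 0`) it
  is never at the mode: `P(X′_n = x₀) = 0` (the tree's sector-filling bound `μKⁿ(A) ≤ μ(A) + n·q(A)`).
* §3 **`iterate_bind_crnPair_apart_eq`** — SHARPNESS: from such a coupling,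
  `P(X_n = x₀, X′_n ≠ x₀) = rⁿ` EXACTLY — the two runs are apart precisely on the event that the cold run is still
  frozen; under `MeasurableEq Ω` (**`iterate_bind_crnPair_offDiagonal_eq`**) `P(X_n ≠ X′_n) = rⁿ` EXACTLY and
  (**`iterate_bind_crnPair_diagonal_eq`**) `P(X_n = X′_n) = 1 − rⁿ`: THE COLD RUN MERGES WITH EVERY OTHER RUN
  EXACTLY WHEN IT FIRST ACCEPTS — GEN-33's thaw time `T` (`P(T > n) = rⁿ`, `X_T ∼ π` independent of `T`) is the
  merging time of the grand coupling, simultaneously for all runs fed the same random numbers.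
Reading (gauge files): a cold-started exact gauge sampler and a hot-started one fed the same autoregressive
proposals and uniforms differ after `b` discarded configurations with probability EXACTLY `(1 − A)^b`,
`A = Z/(c^{#B}M^k)` resp. `Z/∏_ℓ c_{#C_ℓ}`.
NOT CLAIMED: the merging law of two non-modal starts (only the bound `rⁿ` of the Split file); anything for proposals
with an atom at the mode.  No `sorry`, no new definitions, nothing cited as a fact.
-/

noncomputable section

namespace Summit.Ventures.LatticeQCDFlow.Exactness

open MeasureTheory ProbabilityTheory Function Set
open scoped ENNReal unitInterval
open Literature.Probability.MarkovChains

variable {Ω : Type*} [MeasurableSpace Ω] {q : Measure Ω} [IsProbabilityMeasure q] {w : Ω → ℝ}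

/-! ## §1 The coordinates of the iterated pair law -/

/-- One shared update, first coordinate: `(m K̂)∘fst⁻¹ = (m∘fst⁻¹) K`. [ours, bookkeeping] -/
theorem bind_crnPair_map_fst (hw : Measurable w) (hw0 : ∀ y, 0 < w y) (Khat : Kernel (Ω × Ω) (Ω × Ω))
    [IsMarkovKernel Khat]
    (hK : ∀ z : Ω × Ω, Khat z = (q.prod (volume : Measure unitInterval)).map (fun p : Ω × unitInterval =>
      ((if (p.2 : ℝ) * w z.1 ≤ w p.1 then p.1 else z.1), (if (p.2 : ℝ) * w z.2 ≤ w p.1 then p.1 else z.2))))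
    (m : Measure (Ω × Ω)) : (m.bind Khat).map Prod.fst = (m.map Prod.fst).bind (indepMH q w) := by
  haveI : Fact (Measurable w) := ⟨hw⟩
  ext B hB
  rw [Measure.map_apply measurable_fst hB, Measure.bind_apply (measurable_fst hB) (Kernel.aemeasurable _),
    Measure.bind_apply hB (Kernel.aemeasurable _),
    lintegral_map (Kernel.measurable_coe (indepMH q w) hB) measurable_fst]
  refine lintegral_congr fun z => ?_
  rw [← crnPair_map_fst hw hw0 Khat hK z, Measure.map_apply measurable_fst hB]

/-- One shared update, second coordinate: `(m K̂)∘snd⁻¹ = (m∘snd⁻¹) K`. [ours, bookkeeping] -/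
theorem bind_crnPair_map_snd (hw : Measurable w) (hw0 : ∀ y, 0 < w y) (Khat : Kernel (Ω × Ω) (Ω × Ω))
    [IsMarkovKernel Khat]
    (hK : ∀ z : Ω × Ω, Khat z = (q.prod (volume : Measure unitInterval)).map (fun p : Ω × unitInterval =>
      ((if (p.2 : ℝ) * w z.1 ≤ w p.1 then p.1 else z.1), (if (p.2 : ℝ) * w z.2 ≤ w p.1 then p.1 else z.2))))
    (m : Measure (Ω × Ω)) : (m.bind Khat).map Prod.snd = (m.map Prod.snd).bind (indepMH q w) := by
  haveI : Fact (Measurable w) := ⟨hw⟩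
  ext B hB
  rw [Measure.map_apply measurable_snd hB, Measure.bind_apply (measurable_snd hB) (Kernel.aemeasurable _),
    Measure.bind_apply hB (Kernel.aemeasurable _),
    lintegral_map (Kernel.measurable_coe (indepMH q w) hB) measurable_snd]
  refine lintegral_congr fun z => ?_
  rw [← crnPair_map_snd hw hw0 Khat hK z, Measure.map_apply measurable_snd hB]

/-- **THE FIRST RUN'S ONE-TIME LAWS**: `(μ̂₀K̂ⁿ)∘fst⁻¹ = (μ̂₀∘fst⁻¹)Kⁿ`. [ours, bookkeeping] -/
theorem iterate_bind_crnPair_map_fst (hw : Measurable w) (hw0 : ∀ y, 0 < w y) (Khat : Kernel (Ω × Ω) (Ω × Ω))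
    [IsMarkovKernel Khat]
    (hK : ∀ z : Ω × Ω, Khat z = (q.prod (volume : Measure unitInterval)).map (fun p : Ω × unitInterval =>
      ((if (p.2 : ℝ) * w z.1 ≤ w p.1 then p.1 else z.1), (if (p.2 : ℝ) * w z.2 ≤ w p.1 then p.1 else z.2))))
    (n : ℕ) (m : Measure (Ω × Ω)) :
    ((fun μ : Measure (Ω × Ω) => μ.bind Khat)^[n] m).map Prod.fst =
      (fun μ : Measure Ω => μ.bind (indepMH q w))^[n] (m.map Prod.fst) := by
  induction n generalizing m with
  | zero => rfl
  | succ n ih => rw [Function.iterate_succ_apply, Function.iterate_succ_apply, ih, bind_crnPair_map_fst hw hw0 Khat hK]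

/-- **THE SECOND RUN'S ONE-TIME LAWS**: `(μ̂₀K̂ⁿ)∘snd⁻¹ = (μ̂₀∘snd⁻¹)Kⁿ`. [ours, bookkeeping] -/
theorem iterate_bind_crnPair_map_snd (hw : Measurable w) (hw0 : ∀ y, 0 < w y) (Khat : Kernel (Ω × Ω) (Ω × Ω))
    [IsMarkovKernel Khat]
    (hK : ∀ z : Ω × Ω, Khat z = (q.prod (volume : Measure unitInterval)).map (fun p : Ω × unitInterval =>
      ((if (p.2 : ℝ) * w z.1 ≤ w p.1 then p.1 else z.1), (if (p.2 : ℝ) * w z.2 ≤ w p.1 then p.1 else z.2))))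
    (n : ℕ) (m : Measure (Ω × Ω)) :
    ((fun μ : Measure (Ω × Ω) => μ.bind Khat)^[n] m).map Prod.snd =
      (fun μ : Measure Ω => μ.bind (indepMH q w))^[n] (m.map Prod.snd) := by
  induction n generalizing m with
  | zero => rfl
  | succ n ih => rw [Function.iterate_succ_apply, Function.iterate_succ_apply, ih, bind_crnPair_map_snd hw hw0 Khat hK]

/-! ## §2 The cold run is at the mode with probability exactly `rⁿ`; a run started off the mode never is -/

/-- **THE COLD RUN IS STILL FROZEN WITH PROBABILITY EXACTLY `rⁿ`** (read on the pair chain): if the first run starts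
at the mode `x₀` and the proposal has no atom there, `P(X_n = x₀) = rⁿ`. [ours] -/
theorem iterate_bind_crnPair_fst_atMode_eq [MeasurableSingletonClass Ω] (hw : Measurable w) (hw0 : ∀ y, 0 < w y)
    {x₀ : Ω} (hmax : ∀ y, w y ≤ w x₀) [IsProbabilityMeasure (q.withDensity fun y => ENNReal.ofReal (w y))]
    (hq0 : q {x₀} = 0) (Khat : Kernel (Ω × Ω) (Ω × Ω)) [IsMarkovKernel Khat]
    (hK : ∀ z : Ω × Ω, Khat z = (q.prod (volume : Measure unitInterval)).map (fun p : Ω × unitInterval =>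
      ((if (p.2 : ℝ) * w z.1 ≤ w p.1 then p.1 else z.1), (if (p.2 : ℝ) * w z.2 ≤ w p.1 then p.1 else z.2))))
    (n : ℕ) (μ₀ : Measure (Ω × Ω)) [IsProbabilityMeasure μ₀] (hfst : μ₀.map Prod.fst = Measure.dirac x₀) :
    ((fun m : Measure (Ω × Ω) => m.bind Khat)^[n] μ₀).real {p | p.1 = x₀} = (1 - (w x₀)⁻¹) ^ n := by
  have hW : 1 ≤ w x₀ := one_le_of_mode (q := q) hmax
  have hr0 : 0 ≤ 1 - (w x₀)⁻¹ := sub_nonneg.2 (inv_le_one_of_one_le₀ hW)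
  have hr1 : 1 - (w x₀)⁻¹ ≤ 1 := sub_le_self _ (inv_nonneg.mpr (hw0 x₀).le)
  have hset : {p : Ω × Ω | p.1 = x₀} = Prod.fst ⁻¹' {x₀} := by ext p; simp
  have hπ0 : (q.withDensity fun y => ENNReal.ofReal (w y)) {x₀} = 0 := by
    rw [withDensity_apply _ (measurableSet_singleton x₀), Measure.restrict_singleton, hq0, zero_smul,
      lintegral_zero_measure]
  rw [hset, measureReal_def, ← Measure.map_apply measurable_fst (measurableSet_singleton x₀),
    iterate_bind_crnPair_map_fst hw hw0 Khat hK n μ₀, hfst, iterate_bind_indepMH_dirac_mode_eq hw hw0 hmax n]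
  simp only [Measure.add_apply, Measure.smul_apply, smul_eq_mul, hπ0, mul_zero, zero_add,
    Measure.dirac_apply' x₀ (measurableSet_singleton x₀), indicator_of_mem (mem_singleton x₀), Pi.one_apply,
    mul_one, ENNReal.toReal_ofReal (pow_nonneg hr0 n)]

/-- **A RUN STARTED OFF THE MODE IS NEVER AT THE MODE** (atom-free proposal): if `μ̂₀(X′_0 = x₀) = 0` and
`q{x₀} = 0` then `P(X′_n = x₀) = 0` for every `n`. [ours] -/
theorem iterate_bind_crnPair_snd_atMode_eq_zero [MeasurableSingletonClass Ω] (hw : Measurable w)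
    (hw0 : ∀ y, 0 < w y) {x₀ : Ω} (hq0 : q {x₀} = 0) (Khat : Kernel (Ω × Ω) (Ω × Ω)) [IsMarkovKernel Khat]
    (hK : ∀ z : Ω × Ω, Khat z = (q.prod (volume : Measure unitInterval)).map (fun p : Ω × unitInterval =>
      ((if (p.2 : ℝ) * w z.1 ≤ w p.1 then p.1 else z.1), (if (p.2 : ℝ) * w z.2 ≤ w p.1 then p.1 else z.2))))
    (n : ℕ) (μ₀ : Measure (Ω × Ω)) [IsProbabilityMeasure μ₀] (hsnd : (μ₀.map Prod.snd) {x₀} = 0) :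
    ((fun m : Measure (Ω × Ω) => m.bind Khat)^[n] μ₀) {p | p.2 = x₀} = 0 := by
  haveI : IsProbabilityMeasure (μ₀.map Prod.snd) := Measure.isProbabilityMeasure_map measurable_snd.aemeasurable
  have hset : {p : Ω × Ω | p.2 = x₀} = Prod.snd ⁻¹' {x₀} := by ext p; simp
  rw [hset, ← Measure.map_apply measurable_snd (measurableSet_singleton x₀),
    iterate_bind_crnPair_map_snd hw hw0 Khat hK n μ₀]
  refine le_antisymm ?_ bot_le
  calc ((fun μ : Measure Ω => μ.bind (indepMH q w))^[n] (μ₀.map Prod.snd)) {x₀}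
      ≤ (μ₀.map Prod.snd) {x₀} + n * q {x₀} := iterate_bind_indepMH_apply_le hw (measurableSet_singleton x₀) n _
    _ = 0 := by rw [hsnd, hq0, mul_zero, add_zero]

/-! ## §3 Sharpness: apart exactly when the cold run is frozen -/

/-- **SHARPNESS OF THE MERGING BOUND.**  `w` measurable, positive, normalised, maximal at `x₀`; `q{x₀} = 0`;
`K̂` a CRN pair kernel; the initial coupling puts the first run at the mode and the second run off it
(`μ̂₀∘fst⁻¹ = δ_{x₀}`, `μ̂₀(X′_0 = x₀) = 0` — e.g. cold + hot start).  Then for every `n`: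
`P(X_n = x₀, X′_n ≠ x₀) = rⁿ` EXACTLY — the two runs are apart precisely when the cold run is still frozen. [ours] -/
theorem iterate_bind_crnPair_apart_eq [MeasurableSingletonClass Ω] (hw : Measurable w) (hw0 : ∀ y, 0 < w y)
    {x₀ : Ω} (hmax : ∀ y, w y ≤ w x₀) [IsProbabilityMeasure (q.withDensity fun y => ENNReal.ofReal (w y))]
    (hq0 : q {x₀} = 0) (Khat : Kernel (Ω × Ω) (Ω × Ω)) [IsMarkovKernel Khat]
    (hK : ∀ z : Ω × Ω, Khat z = (q.prod (volume : Measure unitInterval)).map (fun p : Ω × unitInterval =>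
      ((if (p.2 : ℝ) * w z.1 ≤ w p.1 then p.1 else z.1), (if (p.2 : ℝ) * w z.2 ≤ w p.1 then p.1 else z.2))))
    (n : ℕ) (μ₀ : Measure (Ω × Ω)) [IsProbabilityMeasure μ₀] (hfst : μ₀.map Prod.fst = Measure.dirac x₀)
    (hsnd : (μ₀.map Prod.snd) {x₀} = 0) :
    ((fun m : Measure (Ω × Ω) => m.bind Khat)^[n] μ₀).real {p | p.1 = x₀ ∧ p.2 ≠ x₀} = (1 - (w x₀)⁻¹) ^ n := by
  haveI hP : IsProbabilityMeasure ((fun m : Measure (Ω × Ω) => m.bind Khat)^[n] μ₀) :=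
    isProbabilityMeasure_iterate_bind (κ := Khat) μ₀ n
  set P : Measure (Ω × Ω) := (fun m : Measure (Ω × Ω) => m.bind Khat)^[n] μ₀ with hPdef
  have hA : MeasurableSet {p : Ω × Ω | p.1 = x₀} := measurable_fst (measurableSet_singleton x₀)
  have hB : MeasurableSet {p : Ω × Ω | p.2 = x₀} := measurable_snd (measurableSet_singleton x₀)
  have h1 : P.real {p | p.1 = x₀} = (1 - (w x₀)⁻¹) ^ n :=
    iterate_bind_crnPair_fst_atMode_eq hw hw0 hmax hq0 Khat hK n μ₀ hfst
  have h2 : P {p | p.2 = x₀} = 0 := iterate_bind_crnPair_snd_atMode_eq_zero hw hw0 hq0 Khat hK n μ₀ hsnd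
  -- `{X = x₀} = {X = x₀, X′ ≠ x₀} ∪ ({X = x₀} ∩ {X′ = x₀})`, the second piece is null
  have hsplit : {p : Ω × Ω | p.1 = x₀} = {p : Ω × Ω | p.1 = x₀ ∧ p.2 ≠ x₀} ∪ ({p | p.1 = x₀} ∩ {p | p.2 = x₀}) := by
    ext p; constructor
    · intro hp; by_cases h : p.2 = x₀
      · exact Or.inr ⟨hp, h⟩
      · exact Or.inl ⟨hp, h⟩
    · rintro (⟨hp, -⟩ | ⟨hp, -⟩) <;> exact hp
  have hnull : P ({p : Ω × Ω | p.1 = x₀} ∩ {p | p.2 = x₀}) = 0 := measure_mono_null inter_subset_right h2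
  have hdisj : Disjoint {p : Ω × Ω | p.1 = x₀ ∧ p.2 ≠ x₀} ({p | p.1 = x₀} ∩ {p | p.2 = x₀}) := by
    rw [Set.disjoint_left]; rintro p ⟨-, hp⟩ ⟨-, hp'⟩; exact hp hp'
  have hmeas : P {p : Ω × Ω | p.1 = x₀} = P {p : Ω × Ω | p.1 = x₀ ∧ p.2 ≠ x₀} := by
    rw [hsplit, measure_union hdisj (hA.inter hB), hnull, add_zero]
  rw [← h1, measureReal_def, measureReal_def, hmeas]

/-- **`P(X_n ≠ X′_n) = rⁿ` EXACTLY** from (cold, off-mode) under shared random numbers (`MeasurableEq Ω`).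
[ours] -/
theorem iterate_bind_crnPair_offDiagonal_eq [MeasurableSingletonClass Ω] (hw : Measurable w) (hw0 : ∀ y, 0 < w y)
    {x₀ : Ω} (hmax : ∀ y, w y ≤ w x₀) [IsProbabilityMeasure (q.withDensity fun y => ENNReal.ofReal (w y))]
    (hq0 : q {x₀} = 0) [MeasurableEq Ω] (Khat : Kernel (Ω × Ω) (Ω × Ω))
    [IsMarkovKernel Khat]
    (hK : ∀ z : Ω × Ω, Khat z = (q.prod (volume : Measure unitInterval)).map (fun p : Ω × unitInterval =>
      ((if (p.2 : ℝ) * w z.1 ≤ w p.1 then p.1 else z.1), (if (p.2 : ℝ) * w z.2 ≤ w p.1 then p.1 else z.2))))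
    (n : ℕ) (μ₀ : Measure (Ω × Ω)) [IsProbabilityMeasure μ₀] (hfst : μ₀.map Prod.fst = Measure.dirac x₀)
    (hsnd : (μ₀.map Prod.snd) {x₀} = 0) :
    ((fun m : Measure (Ω × Ω) => m.bind Khat)^[n] μ₀).real (Set.diagonal Ω)ᶜ = (1 - (w x₀)⁻¹) ^ n := by
  haveI hP : IsProbabilityMeasure ((fun m : Measure (Ω × Ω) => m.bind Khat)^[n] μ₀) :=
    isProbabilityMeasure_iterate_bind (κ := Khat) μ₀ n
  refine le_antisymm ?_ ?_
  · -- `P(off-diagonal) = 1 − P(diagonal) ≤ rⁿ`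
    have h := iterate_bind_crnPair_diagonal_ge hw hw0 hmax Khat hK n μ₀
    rw [measureReal_compl measurableSet_diagonal, probReal_univ]
    linarith
  · -- `{X = x₀, X′ ≠ x₀} ⊆ off-diagonal`
    rw [← iterate_bind_crnPair_apart_eq hw hw0 hmax hq0 Khat hK n μ₀ hfst hsnd]
    refine measureReal_mono ?_
    rintro p ⟨h1, h2⟩ hp
    rw [Set.mem_diagonal_iff] at hp
    exact h2 (hp ▸ h1)

/-- **`P(X_n = X′_n) = 1 − rⁿ` EXACTLY** from (cold, off-mode) under shared random numbers (`MeasurableEq Ω`):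
THE COLD RUN MERGES WITH EVERY OTHER RUN EXACTLY WHEN IT FIRST ACCEPTS. [ours] -/
theorem iterate_bind_crnPair_diagonal_eq [MeasurableSingletonClass Ω] (hw : Measurable w) (hw0 : ∀ y, 0 < w y)
    {x₀ : Ω} (hmax : ∀ y, w y ≤ w x₀) [IsProbabilityMeasure (q.withDensity fun y => ENNReal.ofReal (w y))]
    (hq0 : q {x₀} = 0) [MeasurableEq Ω] (Khat : Kernel (Ω × Ω) (Ω × Ω))
    [IsMarkovKernel Khat]
    (hK : ∀ z : Ω × Ω, Khat z = (q.prod (volume : Measure unitInterval)).map (fun p : Ω × unitInterval =>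
      ((if (p.2 : ℝ) * w z.1 ≤ w p.1 then p.1 else z.1), (if (p.2 : ℝ) * w z.2 ≤ w p.1 then p.1 else z.2))))
    (n : ℕ) (μ₀ : Measure (Ω × Ω)) [IsProbabilityMeasure μ₀] (hfst : μ₀.map Prod.fst = Measure.dirac x₀)
    (hsnd : (μ₀.map Prod.snd) {x₀} = 0) :
    ((fun m : Measure (Ω × Ω) => m.bind Khat)^[n] μ₀).real (Set.diagonal Ω) = 1 - (1 - (w x₀)⁻¹) ^ n := by
  haveI hP : IsProbabilityMeasure ((fun m : Measure (Ω × Ω) => m.bind Khat)^[n] μ₀) :=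
    isProbabilityMeasure_iterate_bind (κ := Khat) μ₀ n
  have h := iterate_bind_crnPair_offDiagonal_eq hw hw0 hmax hq0 Khat hK n μ₀ hfst hsnd
  rw [measureReal_compl measurableSet_diagonal, probReal_univ] at h
  linarith

end Summit.Ventures.LatticeQCDFlow.Exactness

end
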